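import Mathlib
import Summits.Ventures.HodgeRepro.Tier4.Common.AdelicRTF
import Summits.Ventures.HodgeRepro.Tier4.Common.ThetaLift
import Summits.Ventures.HodgeRepro.Tier4.Line4.ThetaRungs
import Summits.Ventures.HodgeRepro.Tier4.Line4.ThetaEquivariance

/-!
# Tier4/Line4/SpectralKernelFamily — the relative-trace-formula kernels `K_f` ARE a kernel family, and the mixed period
of their theta lift is the distribution `Jc f`: decomposition B of the L4 wall with the tree's own kernels, its content
hypothesis literally `R.Jc f ≠ 0` (= W5 of decomposition A, t4-L4-p2's `TwoTorusSpectral`)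

Blind re-derivation cell `pub-hodge-repro`, Tier 4 «prove the step» (README §9–§10), seat t4-L4-p1 (gen 2).  Tree path
`lean/Summits/Ventures/HodgeRepro/Tier4/Line4/SpectralKernelFamily.lean`.  Imports `Common/AdelicRTF` (`kernel`,
`RTFData.Jc`), typer-2's `Common/ThetaLift` (`KernelFamily`, `thetaLift`, `thetaSpan`), `Line4/ThetaRungs`
(`kernelTwoTorusPeriod`, `mixedPeriod_thetaLift_eq`) and `Line4/ThetaEquivariance` (the kernel-level W3).

WHAT IS PROVED.  For a test function `f` on `G(𝔸)` the RTF kernel `K_f(x, y) = ∑_{γ ∈ G(k)} f(x⁻¹ γ y)` read as a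
kernel on `T′(𝔸) × G(𝔸)`, `Θ_f(t, g) := K_f(g, t)` (`spectralKernel`), is (a) left `G(k)`-invariant in `g` and (b)
left `T′(k)`-invariant in `t` (reindexing the rational sum), (c) DIAGONALLY invariant, `Θ_f(t c, g c) = Θ_f(t, g)`
for `c ∈ T′(𝔸)`, as soon as `f` is invariant under conjugation by `T′(𝔸)`, and (d) right translation of `Θ_f` in `g`
is `Θ_{f(h⁻¹ ·)}`.  Hence a set `S` of test functions closed under left translation gives a `KernelFamily`
(`spectralFamily`) — typer-2's abstract structure has a concrete instance in the tree (not the theta kernel of the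
pair: the spectral kernel of the trace formula, which is what the seesaw's `∑_V L_V ∑_f \bar f(t) f(g)` is after
the Rallis inner product).  THE PERIOD IDENTITY: `kernelTwoTorusPeriod R Θ_f = R.Jc f` (definitionally), so by
`mixedPeriod_thetaLift_eq` the mixed period of the lift `θ(χ̄′; Θ_f)` IS the two-character distribution `Jc f` of
`AdelicRTF` (`mixedPeriod_thetaLift_spectralKernel`).  COROLLARY (`exists_admissible_mixed_of_spectralKernel`): the
wall's conclusion W3 from a test-function set `S`, a `T′`-conjugation-invariant `f ∈ S` with `θ(χ̄′; Θ_f)(1) ≠ 0`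
and **`R.Jc f ≠ 0`**, plus the spectral clauses (ii)–(vii) on the span of the lifts — the content hypothesis of
decomposition B is now the SAME displayed number as W5 of decomposition A (`J ≠ 0` for the double period of `K_f`).

HC_CM is NOT proved by anyone in this repository.
-/

set_option autoImplicit false

noncomputable section

namespace Summit.Ventures.HodgeRepro.Tier4.Line4

open Summit.Ventures.HodgeRepro.Tier4.Common MeasureTheory NumberField

section Invariance

variable {k : Type} [Field k] [NumberField k] (W : PlaneData k)

/-- **The RTF kernel is left `G(k)`-invariant in its first variable**: `K_f(γ₀ x, y) = K_f(x, y)` (reindex `γ ↦ γ₀⁻¹ γ`). -/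
theorem kernel_mul_left_rational (f : GA W → ℂ) {γ₀ : GA W} (hγ₀ : γ₀ ∈ rationalPoints W) (x y : GA W) :
    kernel W f (γ₀ * x) y = kernel W f x y := by
  have h := Equiv.tsum_eq (Equiv.mulLeft ((⟨γ₀, hγ₀⟩ : rationalPoints W)⁻¹))
    (fun γ : rationalPoints W => f (x⁻¹ * (γ : GA W) * y))
  unfold kernel
  rw [← h]
  congr 1
  funext γ
  simp only [Equiv.coe_mulLeft, Subgroup.coe_mul, Subgroup.coe_inv, mul_inv_rev, mul_assoc]

/-- **The RTF kernel is left `G(k)`-invariant in its second variable**: `K_f(x, δ y) = K_f(x, y)` (reindex `γ ↦ γ δ`). -/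
theorem kernel_mul_right_rational (f : GA W → ℂ) {δ : GA W} (hδ : δ ∈ rationalPoints W) (x y : GA W) :
    kernel W f x (δ * y) = kernel W f x y := by
  have h := Equiv.tsum_eq (Equiv.mulRight ((⟨δ, hδ⟩ : rationalPoints W)))
    (fun γ : rationalPoints W => f (x⁻¹ * (γ : GA W) * y))
  unfold kernel
  rw [← h]
  congr 1
  funext γ
  simp only [Equiv.coe_mulRight, Subgroup.coe_mul, mul_assoc]

/-- **Diagonal invariance of the RTF kernel** under an element `c` whose conjugation fixes `f`:
`K_f(x c, y c) = K_f(x, y)`. -/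
theorem kernel_mul_mul_of_conj_invariant (f : GA W → ℂ) {c : GA W} (hf : ∀ z, f (c⁻¹ * z * c) = f z)
    (x y : GA W) : kernel W f (x * c) (y * c) = kernel W f x y := by
  unfold kernel
  congr 1
  funext γ
  rw [← hf (x⁻¹ * (γ : GA W) * y)]
  congr 1
  simp only [mul_inv_rev, mul_assoc]

/-- **Right translation of the RTF kernel is the kernel of the left-translated test function**:
`K_f(x h, y) = K_{f(h⁻¹ ·)}(x, y)`. -/
theorem kernel_mul_right_eq (f : GA W → ℂ) (h x y : GA W) :
    kernel W f (x * h) y = kernel W (fun z => f (h⁻¹ * z)) x y := by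
  unfold kernel
  congr 1
  funext γ
  simp only [mul_inv_rev, mul_assoc]

end Invariance

section Family

variable {k : Type} [Field k] [NumberField k] (W : PlaneData k)

/-- **The spectral kernel of a test function as a kernel on `T′(𝔸) × G(𝔸)`**: `Θ_f(t, g) := K_f(g, t)`. -/
def spectralKernel (f : GA W → ℂ) : torusT' W → GA W → ℂ := fun t g => kernel W f g (t : GA W)

/-- `Θ_f` is left `G(k)`-invariant in `g`. -/
theorem spectralKernel_left_invariant (f : GA W → ℂ) {γ : GA W} (hγ : γ ∈ rationalPoints W) (t : torusT' W)
    (g : GA W) : spectralKernel W f t (γ * g) = spectralKernel W f t g :=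
  kernel_mul_left_rational W f hγ g t

/-- `Θ_f` is left `T′(k)`-invariant in `t`. -/
theorem spectralKernel_torus_invariant (f : GA W → ℂ) (δ : rationalOf W (torusT' W)) (t : torusT' W) (g : GA W) :
    spectralKernel W f ((δ : torusT' W) * t) g = spectralKernel W f t g := by
  have hδ : ((δ : torusT' W) : GA W) ∈ rationalPoints W := Subgroup.mem_subgroupOf.1 δ.2
  unfold spectralKernel
  rw [Subgroup.coe_mul]
  exact kernel_mul_right_rational W f hδ g t

/-- **`Θ_f` is diagonally invariant** under `T′(𝔸)` when `f` is invariant under conjugation by `T′(𝔸)`. -/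
theorem spectralKernel_diag (f : GA W → ℂ) (hf : ∀ (c : torusT' W) (z : GA W), f ((c : GA W)⁻¹ * z * c) = f z)
    (t c : torusT' W) (g : GA W) : spectralKernel W f (t * c) (g * c) = spectralKernel W f t g := by
  unfold spectralKernel
  rw [Subgroup.coe_mul]
  exact kernel_mul_mul_of_conj_invariant W f (hf c) g t

/-- Right translation of `Θ_f` in `g` is `Θ_{f(h⁻¹ ·)}`. -/
theorem spectralKernel_right (f : GA W → ℂ) (h : GA W) :
    (fun t g => spectralKernel W f t (g * h)) = spectralKernel W (fun z => f (h⁻¹ * z)) := by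
  funext t g
  exact kernel_mul_right_eq W f h g t

/-- **The spectral kernels of a left-translation-stable set of test functions form a `KernelFamily`** — a concrete
instance of typer-2's structure in the tree (the RTF kernels, not the theta kernel of the pair). -/
def spectralFamily (S : Set (GA W → ℂ)) (hS : ∀ f ∈ S, ∀ h : GA W, (fun z => f (h⁻¹ * z)) ∈ S) :
    KernelFamily W where
  carrier := spectralKernel W '' S
  left_invariant := by
    rintro _ ⟨f, _, rfl⟩ γ hγ t g
    exact spectralKernel_left_invariant W f hγ t g
  torus_invariant := by
    rintro _ ⟨f, _, rfl⟩ δ t g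
    exact spectralKernel_torus_invariant W f δ t g
  right_stable := by
    rintro _ ⟨f, hf, rfl⟩ h
    exact ⟨fun z => f (h⁻¹ * z), hS f hf h, (spectralKernel_right W f h).symm⟩

/-- `Θ_f` is a member of the family for `f ∈ S`. -/
theorem spectralKernel_mem_spectralFamily (S : Set (GA W → ℂ))
    (hS : ∀ f ∈ S, ∀ h : GA W, (fun z => f (h⁻¹ * z)) ∈ S) {f : GA W → ℂ} (hf : f ∈ S) :
    spectralKernel W f ∈ (spectralFamily W S hS).carrier :=
  ⟨f, hf, rfl⟩

end Family

section Period

variable {k : Type} [Field k] [NumberField k] {W : PlaneData k}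
  [MeasurableSpace (torusT W)] [MeasurableSpace (torusT' W)] (R : RTFData W)

/-- **The two-torus period of the spectral kernel is the distribution `Jc f`** (definitionally). -/
theorem kernelTwoTorusPeriod_spectralKernel (f : GA W → ℂ) :
    kernelTwoTorusPeriod R (spectralKernel W f) = R.Jc f := rfl

/-- **The mixed period of the theta lift of the spectral kernel is `Jc f`** (integrability of
`t ↦ χ̄′(t) K_f(s, t)` over `D_{T′}` for each `s ∈ T(𝔸)` DISPLAYED, as in `mixedPeriod_thetaLift_eq`). -/
theorem mixedPeriod_thetaLift_spectralKernel (f : GA W → ℂ)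
    (hint : ∀ s : torusT W, Integrable (fun t => conjChar W R.chi' t * kernel W f (s : GA W) (t : GA W))
      (R.μT'.restrict R.DT')) :
    periodLin W R.μT R.DT R.chi
        (restrictTo W (torusT W) (thetaLift R.μT' R.DT' (conjChar W R.chi') (spectralKernel W f))) = R.Jc f := by
  rw [mixedPeriod_thetaLift_eq R hint]
  rfl

end Period

section Rung

variable {k : Type} [Field k] [NumberField k] {W : PlaneData k}
  [MeasurableSpace (torusT W)] [MeasurableSpace (torusT' W)] (R : RTFData W)
  (S : Set (GA W → ℂ)) (hS : ∀ f ∈ S, ∀ h : GA W, (fun z => f (h⁻¹ * z)) ∈ S)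
  (q : QuadData k) (g g' : Matrix (Fin 4) (Fin 4) k) (w₀ : InfinitePlace k) (eP eM eP' eM' : InfinitePlace k → ℤ)

/-- **RUNG W3 WITH THE TREE'S OWN KERNELS** (= the conclusion of the wall `mixed_two_torus_W3`, generic `W`): from a
left-translation-stable set `S` of test functions, a `T′`-conjugation-invariant `f ∈ S` with `θ(χ̄′; Θ_f)(1) ≠ 0`
and **`R.Jc f ≠ 0`** (W5 of decomposition A, the two-character distribution of the trace formula), the
integrability of the inner period, and the spectral clauses (ii)–(vii) on `V := thetaSpan (spectralFamily S) …`.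
Structural: `[MeasurableMul (torusT' W)]`, `hR : R.IsHaar`, commutativity of `T′(𝔸)` (`torusT'_mul_comm` on the
seesaw plane). -/
theorem exists_admissible_mixed_of_spectralKernel [MeasurableMul (torusT' W)] (hR : R.IsHaar)
    (hcomm : ∀ s t : torusT' W, s * t = t * s)
    {f : GA W → ℂ} (hfS : f ∈ S) (hf : ∀ (c : torusT' W) (z : GA W), f ((c : GA W)⁻¹ * z * c) = f z)
    (h1 : thetaLift R.μT' R.DT' (conjChar W R.chi') (spectralKernel W f) 1 ≠ 0)
    (hJ : R.Jc f ≠ 0)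
    (hint : ∀ s : torusT W, Integrable (fun t => conjChar W R.chi' t * kernel W f (s : GA W) (t : GA W))
      (R.μT'.restrict R.DT'))
    (hirr : ∀ V₀ ≤ thetaSpan (spectralFamily W S hS) R.μT' R.DT' (conjChar W R.chi'), IsAutomorphicSubspace W V₀ →
      V₀ = ⊥ ∨ V₀ = thetaSpan (spectralFamily W S hS) R.μT' R.DT' (conjChar W R.chi'))
    (hcusp : IsCuspidalSubspace W (thetaSpan (spectralFamily W S hS) R.μT' R.DT' (conjChar W R.chi')))
    (hK : ∀ w, ∃ Θ ∈ (spectralFamily W S hS).carrier, thetaLift R.μT' R.DT' (conjChar W R.chi') Θ ≠ 0 ∧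
      ∀ (x κ : GA W), κ ∈ localTorusAt W w → ∀ t,
        Θ t (x * κ) = weightAt W q w 0 κ ^ eP w * weightAt W q w 1 κ ^ eM w * Θ t x)
    (hlow : ∀ j : ℤ, |(eP w₀ - eM w₀) + 2 * j| < 3 →
      ¬ HasKTypeAt W q w₀ (eP w₀ + j) (eM w₀ - j)
        (thetaSpan (spectralFamily W S hS) R.μT' R.DT' (conjChar W R.chi')))
    (hK' : ∀ w, ∃ Θ ∈ (spectralFamily W S hS).carrier, thetaLift R.μT' R.DT' (conjChar W R.chi') Θ ≠ 0 ∧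
      ∀ (x κ : GA W), κ ∈ localTorusAt' W w → ∀ t,
        Θ t (x * κ) = weightAt' W q w g g' 0 κ ^ eP' w * weightAt' W q w g g' 1 κ ^ eM' w * Θ t x)
    (hlow' : ∀ j : ℤ, |(eP' w₀ - eM' w₀) + 2 * j| < 3 →
      ¬ HasKTypeAt' W q w₀ g g' (eP' w₀ + j) (eM' w₀ - j)
        (thetaSpan (spectralFamily W S hS) R.μT' R.DT' (conjChar W R.chi'))) :
    ∃ V : Submodule ℂ (GA W → ℂ), IsAdmissible W q g g' w₀ eP eM eP' eM' V ∧ HasNonzeroMixedPeriod W R V :=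
  exists_admissible_mixed_of_kernelFamily_isHaar R (spectralFamily W S hS) q g g' w₀ eP eM eP' eM' hR hcomm
    ⟨spectralKernel W f, spectralKernel_mem_spectralFamily W S hS hfS, spectralKernel_diag W f hf, h1,
      by rw [mixedPeriod_thetaLift_spectralKernel R f hint]; exact hJ⟩
    hirr hcusp hK hlow hK' hlow'

end Rung

end Summit.Ventures.HodgeRepro.Tier4.Line4

end
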